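import Mathlib
import Summits.Ventures.PercRepro2.Defs
import Summits.Ventures.PercRepro2.Independence
import Summits.Ventures.PercRepro2.Harris
import Summits.Ventures.PercRepro2.ThreeEventSafe
import Summits.Ventures.PercRepro2.ThreeEventCross
import Summits.Ventures.PercRepro2.ThreeEventCertificate
import Summits.Ventures.PercRepro2.ThreeEventCertificateSwap
import Summits.Ventures.PercRepro2.ThreeEventCertificateInduction

/-!
# The certificate induction BY SECTIONS (blind cell PercRepro2, p4 g34; proofs/P4-G33-CROSS.md §4e,
repair R2 of the S3 score: the pointwise clause restricted to the support of the weight vector)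

The certificate induction `defect_nonneg_of_sym_certificates` (ThreeEventCertificateInduction) asks, at
every weight vector `p`, for an unpinned edge `e` with a symmetrised pointwise certificate on ALL
configurations with `e` open. That clause does not see `p`, so at a weight vector pinned everywhere
except at `f` it hands a certificate at `f`: that hypothesis is the EVERY-EDGE form (∀-SYM).

Here the clause is restricted to the SUPPORT of `p` — `InSupport p ω`: `ω` agrees with every pinned
edge of `p` — which is all the double sums ever weigh (`weight p ω = 0` off the support,
`weight_eq_zero_of_not_inSupport`). At a weight vector with `k` unpinned edges the clause is then a
statement about the `k`-dimensional SECTION only (a pinned edge `f` is never asked for a certificate: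
the clause at `p[f ↦ 1]` is the one-point inequality at the pinned configuration), so the hypothesis
`hcert` of `defect_nonneg_of_sym_certificates_sec` is the SECTION form (∃-SYM-sec): every admissible
quadruple, restricted to every section of the cube, has an unpinned edge with a symmetrised pointwise
certificate on that section. The induction is the same as before
(`Ψ_p = a²Ψ_{p[e↦1]} + (1−a)²Ψ_{p[e↦0]} + a(1−a)X_p(e)`, the two section defects by the induction
hypothesis, `X_p(e) ≥ λ₁Ψ_{p[e↦1]}(1) + λ₂Ψ_{p[e↦1]}(2)` by the certificate summed against the
weights of `p[e↦1]`, which vanish off the support: `crossTerm_ge_of_pointwise_sym_sec`).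
`cov_inter_le_cov_of_sym_certificates_sec` specialises to the class of admissible quadruples; the
Ahlswede–Daykin extension is ThreeEventCertificateSectionsAD. One definition (`InSupport`), no
instance, no notation.
-/

namespace Summit.Ventures.PercRepro2

namespace ThreeEvent

section Support

variable {E : Type*} [Fintype E] [DecidableEq E] {R : Type*} [CommRing R]

/-- The SUPPORT (section) of a weight vector `p`: the configurations that agree with every pinned
edge of `p` — `ω f = true` where `p f = 1` and `ω f = false` where `p f = 0`. -/
def InSupport (p : E → R) (ω : Config E) : Prop :=
  ∀ f, (p f = 1 → ω f = true) ∧ (p f = 0 → ω f = false)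

/-- Off the support the weight vanishes: a pinned edge in the wrong state contributes the factor
`edgeFactor 1 false = 0` or `edgeFactor 0 true = 0`. -/
lemma weight_eq_zero_of_not_inSupport (p : E → R) {ω : Config E} (h : ¬ InSupport p ω) :
    weight p ω = 0 := by
  classical
  by_contra hw
  apply h
  intro f
  refine ⟨fun h1 => ?_, fun h0 => ?_⟩
  · by_contra hf
    have hf' : ω f = false := by simpa using hf
    apply hw
    rw [weight_eq_mul_edgeFactor p ω f, hf', h1]
    simp
  · by_contra hf
    have hf' : ω f = true := by simpa using hf
    apply hw
    rw [weight_eq_mul_edgeFactor p ω f, hf', h0]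
    simp

end Support

section Certificate

variable {E : Type*} [Fintype E] [DecidableEq E] {R : Type*} [CommRing R] [LinearOrder R]
  [IsStrictOrderedRing R]

omit [IsStrictOrderedRing R] in
/-- The support of `p[e ↦ 1]`, for an unpinned edge `e`, is the support of `p` with `e` open. -/
lemma inSupport_of_inSupport_update_one {p : E → R} {e : E} (he : e ∈ unpinned p) {ω : Config E}
    (h : InSupport (Function.update p e 1) ω) : InSupport p ω ∧ ω e = true := by
  refine ⟨fun f => ?_, (h e).1 (by simp)⟩
  by_cases hf : f = e
  · subst hf
    simp only [unpinned, Finset.mem_filter, Finset.mem_univ, true_and] at he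
    exact ⟨fun h1 => absurd h1 he.2, fun h0 => absurd h0 he.1⟩
  · have := h f
    rwa [Function.update_of_ne hf] at this

/-- **Symmetrised pointwise certificates on the support.** If, on the configurations of the support
of `p` with `e` open, `λ₁ (c₁(ω,ω') + c₁(ω',ω)) + λ₂ (c₂(ω,ω') + c₂(ω',ω)) ≤ χ(ω,ω') + χ(ω',ω)`, then
`2 (λ₁ Ψ_{p[e↦1]}(1) + λ₂ Ψ_{p[e↦1]}(2)) ≤ 2 X_p(e)` (`e` unpinned). -/
theorem crossTerm_ge_of_pointwise_sym_sec {p : E → R} (hp : IsProbVec p) {e : E}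
    (he : e ∈ unpinned p) (G H M B G₁ H₁ M₁ B₁ G₂ H₂ M₂ B₂ : Set (Config E)) (l₁ l₂ : R)
    (hcert : ∀ ω ω' : Config E, InSupport p ω → InSupport p ω' → ω e = true → ω' e = true →
      l₁ * (pairWt G₁ H₁ M₁ B₁ ω ω' + pairWt G₁ H₁ M₁ B₁ ω' ω)
        + l₂ * (pairWt G₂ H₂ M₂ B₂ ω ω' + pairWt G₂ H₂ M₂ B₂ ω' ω)
        ≤ (pairWt G H M B (Function.update ω e false) ω'
            + pairWt G H M B ω (Function.update ω' e false))
          + (pairWt G H M B (Function.update ω' e false) ω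
            + pairWt G H M B ω' (Function.update ω e false))) :
    2 * (l₁ * defect (Function.update p e 1) G₁ H₁ M₁ B₁
      + l₂ * defect (Function.update p e 1) G₂ H₂ M₂ B₂) ≤ 2 * crossTerm p e G H M B := by
  rw [mul_add, mul_left_comm, mul_left_comm (2 : R), two_mul_defect_eq', two_mul_defect_eq',
    two_mul_crossTerm_eq']
  simp only [Finset.mul_sum]
  rw [← Finset.sum_add_distrib]
  refine Finset.sum_le_sum fun ω _ => ?_
  rw [← Finset.sum_add_distrib]
  refine Finset.sum_le_sum fun ω' _ => ?_
  have hq : IsProbVec (Function.update p e 1) := hp.update e zero_le_one le_rfl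
  have hw : 0 ≤ weight (Function.update p e 1) ω * weight (Function.update p e 1) ω' :=
    mul_nonneg (weight_nonneg hq ω) (weight_nonneg hq ω')
  by_cases hs : InSupport (Function.update p e 1) ω
  · by_cases hs' : InSupport (Function.update p e 1) ω'
    · obtain ⟨h1, he1⟩ := inSupport_of_inSupport_update_one he hs
      obtain ⟨h2, he2⟩ := inSupport_of_inSupport_update_one he hs'
      have := mul_le_mul_of_nonneg_left (hcert ω ω' h1 h2 he1 he2) hw
      linarith [this]
    · rw [weight_eq_zero_of_not_inSupport _ hs']
      simp
  · rw [weight_eq_zero_of_not_inSupport _ hs]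
    simp

end Certificate

section Induction

variable {E : Type*} [Fintype E] [DecidableEq E] {R : Type*} [CommRing R] [LinearOrder R]
  [IsStrictOrderedRing R]

/-- **The certificate induction by sections.** Let `P` be any class of quadruples. If every quadruple
of the class, at every admissible weight vector `p` with an unpinned edge, has an unpinned edge `e`,
two quadruples of the class and `λ₁, λ₂ ≥ 0` with the symmetrised pointwise certificate on the
configurations OF THE SUPPORT OF `p` with `e` open, then the defect is nonnegative for every quadruple
of the class and every admissible `p`. Induction on the number of unpinned edges, generalising over
the quadruple. -/
theorem defect_nonneg_of_sym_certificates_sec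
    (P : Set (Config E) → Set (Config E) → Set (Config E) → Set (Config E) → Prop)
    (hcert : ∀ (G H M B : Set (Config E)), P G H M B →
      ∀ p : E → R, IsProbVec p → (unpinned p).Nonempty →
        ∃ e ∈ unpinned p, ∃ (G₁ H₁ M₁ B₁ G₂ H₂ M₂ B₂ : Set (Config E)) (l₁ l₂ : R),
          P G₁ H₁ M₁ B₁ ∧ P G₂ H₂ M₂ B₂ ∧ 0 ≤ l₁ ∧ 0 ≤ l₂ ∧
          ∀ ω ω' : Config E, InSupport p ω → InSupport p ω' → ω e = true → ω' e = true →
            l₁ * (pairWt G₁ H₁ M₁ B₁ ω ω' + pairWt G₁ H₁ M₁ B₁ ω' ω)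
              + l₂ * (pairWt G₂ H₂ M₂ B₂ ω ω' + pairWt G₂ H₂ M₂ B₂ ω' ω)
              ≤ (pairWt G H M B (Function.update ω e false) ω'
                  + pairWt G H M B ω (Function.update ω' e false))
                + (pairWt G H M B (Function.update ω' e false) ω
                  + pairWt G H M B ω' (Function.update ω e false))) :
    ∀ (G H M B : Set (Config E)), P G H M B → ∀ p : E → R, IsProbVec p →
      0 ≤ defect p G H M B := by
  classical
  suffices key : ∀ (n : ℕ) (p : E → R), IsProbVec p → (unpinned p).card = n →
      ∀ (G H M B : Set (Config E)), P G H M B → 0 ≤ defect p G H M B by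
    intro G H M B hP p hp
    exact key _ p hp rfl G H M B hP
  intro n
  induction n using Nat.strong_induction_on with
  | _ n ih =>
    intro p hp hn G H M B hP
    by_cases hne : (unpinned p).Nonempty
    · obtain ⟨e, he, G₁, H₁, M₁, B₁, G₂, H₂, M₂, B₂, l₁, l₂, hP₁, hP₂, hl₁, hl₂, hpt⟩ :=
        hcert G H M B hP p hp hne
      have ha0 : 0 ≤ p e := hp.nonneg e
      have ha1 : 0 ≤ 1 - p e := sub_nonneg.2 (hp.le_one e)
      have hcard : ((unpinned p).erase e).card < n := by
        rw [← hn]; exact Finset.card_erase_lt_of_mem he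
      have hp1 : IsProbVec (Function.update p e 1) := hp.update e zero_le_one le_rfl
      have hp0 : IsProbVec (Function.update p e 0) := hp.update e le_rfl zero_le_one
      have hc1 : (unpinned (Function.update p e 1)).card = ((unpinned p).erase e).card := by
        rw [unpinned_update p he 1 (Or.inr rfl)]
      have hc0 : (unpinned (Function.update p e 0)).card = ((unpinned p).erase e).card := by
        rw [unpinned_update p he 0 (Or.inl rfl)]
      have h1 : 0 ≤ defect (Function.update p e 1) G H M B := ih _ hcard _ hp1 hc1 G H M B hP
      have h0 : 0 ≤ defect (Function.update p e 0) G H M B := ih _ hcard _ hp0 hc0 G H M B hP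
      have hJ1 : 0 ≤ defect (Function.update p e 1) G₁ H₁ M₁ B₁ :=
        ih _ hcard _ hp1 hc1 G₁ H₁ M₁ B₁ hP₁
      have hJ2 : 0 ≤ defect (Function.update p e 1) G₂ H₂ M₂ B₂ :=
        ih _ hcard _ hp1 hc1 G₂ H₂ M₂ B₂ hP₂
      have hX2 := crossTerm_ge_of_pointwise_sym_sec hp he G H M B G₁ H₁ M₁ B₁ G₂ H₂ M₂ B₂ l₁ l₂ hpt
      have hX : 0 ≤ crossTerm p e G H M B := by
        have := mul_nonneg hl₁ hJ1
        have := mul_nonneg hl₂ hJ2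
        linarith
      rw [defect_eq_pin_cross p G H M B e]
      have := mul_nonneg (mul_nonneg ha0 ha1) hX
      have := mul_nonneg (pow_nonneg ha0 2) h1
      have := mul_nonneg (pow_nonneg ha1 2) h0
      linarith
    · have hpin : ∀ e, p e = 0 ∨ p e = 1 := fun e => by
        by_contra hcon
        refine hne ⟨e, ?_⟩
        simp only [unpinned, Finset.mem_filter, Finset.mem_univ, true_and]
        exact ⟨fun h => hcon (Or.inl h), fun h => hcon (Or.inr h)⟩
      rw [defect_eq_zero_of_pinned p hpin]

/-- **The three-event lemma modulo (∃-SYM-sec)**: for the class of admissible quadruples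
(increasing `G ⊇ M ⊇ G ∩ B`, increasing `H`, decreasing `B`), the section form of the certificate
hypothesis gives `Cov_p(M, B ∩ H) ≤ Cov_p(G, H)` for every admissible quadruple and weight vector. -/
theorem cov_inter_le_cov_of_sym_certificates_sec
    (hcert : ∀ (G H M B : Set (Config E)),
      (IsUpperSet G ∧ IsUpperSet H ∧ IsUpperSet M ∧ IsLowerSet B ∧ M ⊆ G ∧ G ∩ B ⊆ M) →
      ∀ p : E → R, IsProbVec p → (unpinned p).Nonempty →
        ∃ e ∈ unpinned p, ∃ (G₁ H₁ M₁ B₁ G₂ H₂ M₂ B₂ : Set (Config E)) (l₁ l₂ : R),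
          (IsUpperSet G₁ ∧ IsUpperSet H₁ ∧ IsUpperSet M₁ ∧ IsLowerSet B₁ ∧ M₁ ⊆ G₁ ∧ G₁ ∩ B₁ ⊆ M₁)
          ∧ (IsUpperSet G₂ ∧ IsUpperSet H₂ ∧ IsUpperSet M₂ ∧ IsLowerSet B₂ ∧ M₂ ⊆ G₂ ∧ G₂ ∩ B₂ ⊆ M₂)
          ∧ 0 ≤ l₁ ∧ 0 ≤ l₂ ∧
          ∀ ω ω' : Config E, InSupport p ω → InSupport p ω' → ω e = true → ω' e = true →
            l₁ * (pairWt G₁ H₁ M₁ B₁ ω ω' + pairWt G₁ H₁ M₁ B₁ ω' ω)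
              + l₂ * (pairWt G₂ H₂ M₂ B₂ ω ω' + pairWt G₂ H₂ M₂ B₂ ω' ω)
              ≤ (pairWt G H M B (Function.update ω e false) ω'
                  + pairWt G H M B ω (Function.update ω' e false))
                + (pairWt G H M B (Function.update ω' e false) ω
                  + pairWt G H M B ω' (Function.update ω e false)))
    {G H M B : Set (Config E)} (hG : IsUpperSet G) (hH : IsUpperSet H) (hM : IsUpperSet M)
    (hB : IsLowerSet B) (hMG : M ⊆ G) (hGB : G ∩ B ⊆ M) {p : E → R} (hp : IsProbVec p) :
    prob p (M ∩ (B ∩ H)) - prob p M * prob p (B ∩ H) ≤ prob p (G ∩ H) - prob p G * prob p H :=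
  sub_nonneg.1 (defect_nonneg_of_sym_certificates_sec
    (fun G H M B => IsUpperSet G ∧ IsUpperSet H ∧ IsUpperSet M ∧ IsLowerSet B ∧ M ⊆ G ∧ G ∩ B ⊆ M)
    hcert G H M B ⟨hG, hH, hM, hB, hMG, hGB⟩ p hp)

end Induction

end ThreeEvent

end Summit.Ventures.PercRepro2
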